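import Summits.CriticalPhenomena.SAWScalingLimit.Theorems.SAWLoopFugacityFlowAvoidanceLimitBoundaryChart
import Literature.Probability.RandomPlanarGeometry.ImageUnivalent
import Literature.Probability.RandomPlanarGeometry.CaratheodoryHalfPlane
import Literature.Topology.PlaneTopology.HalfDiscCrosscut
import HarnessLib

/-!
# Local Jordan neighbourhoods at a boundary point of a Jordan domain
— (T) brick of line `symplectic-fermion-anchor`
(crux `SAWLoopFugacityFlow.AvoidanceLimit`, stmt-CriticalPhenomena-10649)

The lattice uniform local connectivity of Jordan domains at a marked boundary point ((T), toward
`stub_uniformBHP`) is proved inside a small JORDAN sub-domain `N` of `D` at `p ∈ ∂D`. This file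
supplies that sub-domain:

* `exists_localJordanNbhd` (registered signature): for every `ρ > 0` there are a Jordan domain
  `N ⊆ D ∩ B(p, ρ)` and `r, m, L > 0` with `D ∩ B(p, r) ⊆ N` and the SEPARATION property — a point
  `a ∈ N` within `m` of a point `c ∈ D̄` of the rest (`c ∈ D ∖ N` or `c ∉ N̄`) is at distance `≥ L`
  from `D ∩ B(p, r)`.

Construction (folklore): the Carathéodory chart `Ψ : 𝔻̄ → D̄`, `Ψ ζ = p`, with uniformly continuous
inverse (`exists_boundaryChart_invUniformContinuous`, from the Riemann mapping theorem and
Carathéodory's theorem, both proved in the tree); the rotated Cayley map `g = -ζ · cayleyFun`, a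
homeomorphism of the closed upper half-plane onto `𝔻̄ ∖ {-ζ}` with `g 0 = ζ` and inverse
`G = cayleyInvFun ((-ζ)⁻¹ ·)`; and `N = (Ψ ∘ g)(half-disc of radius t)` as a `JordanDomain.image` of
`Literature.Topology.PlaneTopology.halfDisc`. In disc coordinates the separation is the positive
distance between the disjoint compact sets `g(closed half-disc of radius s₁)` and
`𝔻̄ ∖ {w ≠ -ζ, ‖G w‖ < s₂}` (`s₁ < s₂`), used for `(s₁, s₂) = (t/2, 3t/4)` and `(t/4, t/2)` and
transported to `D̄` by the uniform continuity of `Ψ⁻¹`.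

Sources: folklore plane topology around Carathéodory's theorem (Pommerenke 1992, Thm. 2.6, proved
in the tree as `JordanDomain.image` / the boundary chart). No definitions, no named facts.
-/

noncomputable section

open scoped Topology
open Literature.Probability.RandomPlanarGeometry

namespace Summit.CriticalPhenomena.SAWScalingLimit.Theorems.AvoidanceLimit.Anchor

open Complex Metric Set
open Literature.Topology.PlaneTopology (halfDisc carrier_halfDisc closure_ball_inter_upperHalfPlaneSet)
open UpperHalfPlane (upperHalfPlaneSet)

/-- Two disjoint compact planar sets are at positive distance. [folklore] -/
private theorem exists_pos_forall_le_dist {s t : Set ℂ} (hs : IsCompact s) (ht : IsCompact t)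
    (hst : ∀ x ∈ s, ∀ y ∈ t, x ≠ y) : ∃ d : ℝ, 0 < d ∧ ∀ x ∈ s, ∀ y ∈ t, d ≤ dist x y := by
  obtain ⟨d, hd, h⟩ := (hs.prod ht).exists_forall_le' continuous_dist.continuousOn (a := (0 : ℝ))
    (fun q hq => dist_pos.2 (hst q.1 hq.1 q.2 hq.2))
  exact ⟨d, hd, fun x hx y hy => h (x, y) ⟨hx, hy⟩⟩

/-- `cayleyFun z ≠ 1` away from the pole. [folklore] -/
private theorem cayleyFun_ne_one {z : ℂ} (hz : z + I ≠ 0) : cayleyFun z ≠ 1 := by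
  intro h
  rw [cayleyFun_apply, div_eq_one_iff_eq hz] at h
  have := congrArg Complex.im h
  simp only [sub_im, I_im, add_im] at this
  linarith

/-- The rotated Cayley map `z ↦ η · cayleyFun z` misses `η`. [folklore] -/
private theorem mul_cayleyFun_ne_self {η z : ℂ} (hη : η ≠ 0) (hz : 0 ≤ z.im) :
    η * cayleyFun z ≠ η := by
  intro h
  exact cayleyFun_ne_one (add_I_ne_zero hz) ((mul_eq_left₀ hη).1 h)

/-- Left inverse of the rotated Cayley map. [folklore] -/
private theorem cayleyInvFun_inv_mul {η z : ℂ} (hη : η ≠ 0) (hz : 0 ≤ z.im) :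
    cayleyInvFun (η⁻¹ * (η * cayleyFun z)) = z := by
  rw [inv_mul_cancel_left₀ hη, cayleyInvFun_cayleyFun (add_I_ne_zero hz)]

/-- Right inverse of the rotated Cayley map away from `η`. [folklore] -/
private theorem mul_cayleyFun_cayleyInvFun {η w : ℂ} (hη : η ≠ 0) (hw : w ≠ η) :
    η * cayleyFun (cayleyInvFun (η⁻¹ * w)) = w := by
  rw [cayleyFun_cayleyInvFun, mul_inv_cancel_left₀ hη]
  rwa [Ne, inv_mul_eq_one₀ hη, eq_comm]

/-- The rotated Cayley map sends the closed upper half-plane into the closed unit disc. [folklore] -/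
private theorem norm_mul_cayleyFun_le {η z : ℂ} (hη : ‖η‖ = 1) (hz : 0 ≤ z.im) :
    ‖η * cayleyFun z‖ ≤ 1 := by
  rw [norm_mul, hη, one_mul]
  exact norm_cayleyFun_le_one hz

/-- The rotated Cayley map sends exactly the open upper half-plane into the open unit disc. [folklore] -/
private theorem norm_mul_cayleyFun_lt_iff {η z : ℂ} (hη : ‖η‖ = 1) (hz : 0 ≤ z.im) :
    ‖η * cayleyFun z‖ < 1 ↔ 0 < z.im := by
  rw [norm_mul, hη, one_mul]
  exact norm_cayleyFun_lt_one_iff (add_I_ne_zero hz)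

/-- The rotated inverse Cayley map sends the closed unit disc into the closed upper half-plane. [folklore] -/
private theorem cayleyInvFun_inv_mul_im_nonneg {η w : ℂ} (hη : ‖η‖ = 1) (hw : ‖w‖ ≤ 1) :
    0 ≤ (cayleyInvFun (η⁻¹ * w)).im := by
  rw [cayleyInvFun_im]
  refine div_nonneg ?_ (normSq_nonneg _)
  rw [sub_nonneg, normSq_eq_norm_sq, norm_mul, norm_inv, hη, inv_one, one_mul]
  exact (sq_le_one_iff₀ (norm_nonneg _)).2 hw

/-- The rotated inverse Cayley map sends the open unit disc into the open upper half-plane. [folklore] -/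
private theorem cayleyInvFun_inv_mul_im_pos {η w : ℂ} (hη : ‖η‖ = 1) (hw : ‖w‖ < 1) :
    0 < (cayleyInvFun (η⁻¹ * w)).im := by
  refine cayleyInvFun_im_pos ?_
  rwa [norm_mul, norm_inv, hη, inv_one, one_mul]

/-- The rotated inverse Cayley map is continuous away from `η`. [folklore] -/
private theorem continuousOn_cayleyInvFun_inv_mul {η : ℂ} (hη : η ≠ 0) :
    ContinuousOn (fun w => cayleyInvFun (η⁻¹ * w)) {w | w ≠ η} := by
  refine differentiableOn_cayleyInvFun.continuousOn.comp (continuous_const_mul _).continuousOn ?_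
  intro w hw
  simp only [mem_setOf_eq] at hw ⊢
  rwa [Ne, inv_mul_eq_one₀ hη, eq_comm]

/-- The rotated Cayley map is continuous on the closed upper half-plane. [folklore] -/
private theorem continuousOn_mul_cayleyFun (η : ℂ) :
    ContinuousOn (fun z => η * cayleyFun z) {z : ℂ | 0 ≤ z.im} :=
  (continuousOn_const.mul continuousOn_cayleyFun).mono fun _ hz => add_I_ne_zero hz

/-- **Local Jordan neighbourhoods at a boundary point, with separation.** For a Jordan domain `D`,
a boundary point `p ∈ ∂D` and `ρ > 0` there are a Jordan domain `N ⊆ D ∩ B(p, ρ)` and radii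
`r, m, L > 0` such that `N` contains all of `D ∩ B(p, r)`, and a point `a ∈ N` lying within `m` of a
point `c` of "the rest of `D̄`" (`c ∈ D ∖ N`, or `c ∈ D̄ ∖ N̄`) is at distance `≥ L` from every point of
`D ∩ B(p, r)`. Construction: in the Carathéodory chart `Ψ : 𝔻̄ → D̄` at `p = Ψ ζ`
(`exists_boundaryChart_invUniformContinuous`) take `N = Ψ(g(half-disc of radius t))`, where
`g = -ζ · cayley` maps the closed upper half-plane into the closed disc with `g 0 = ζ`
(`JordanDomain.image`, `halfDisc`); `r` comes from the uniform continuity of `Ψ⁻¹` and the continuity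
of `g⁻¹` at `ζ`, and `m`, `L` from the positive distances between the compact sets
`g(closed half-disc of radius t/2)` / `𝔻̄ ∖ g(half-disc of radius 3t/4)` and
`g(closed half-disc of radius t/4)` / `𝔻̄ ∖ g(half-disc of radius t/2)`, transported by the uniform
continuity of `Ψ⁻¹`. [folklore] -/
theorem exists_localJordanNbhd :
    ∀ (D : JordanDomain) (p : ℂ), p ∈ frontier D.carrier → ∀ ρ : ℝ, 0 < ρ →
      ∃ (N : JordanDomain) (r m L : ℝ), 0 < r ∧ 0 < m ∧ 0 < L ∧
        N.carrier ⊆ D.carrier ∧ N.carrier ⊆ Metric.ball p ρ ∧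
        (∀ z ∈ D.carrier, dist z p < r → z ∈ N.carrier) ∧
        (∀ a ∈ N.carrier, ∀ c ∈ closure D.carrier,
          (c ∈ D.carrier ∧ c ∉ N.carrier) ∨ c ∉ closure N.carrier → dist a c < m →
          ∀ z ∈ D.carrier, dist z p < r → L ≤ dist z a) := by
  intro D p hp ρ hρ
  obtain ⟨φ, Ψ, ζ, hζ, hζp, hΨc, hΨφ, hbij, -, hU⟩ :=
    exists_boundaryChart_invUniformContinuous D p hp
  have hΨi : InjOn Ψ (closedBall 0 1) := hbij.injOn
  have hΨball : Ψ '' ball 0 1 = D.carrier := hΨφ.image_eq.trans φ.bijOn.image_eq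
  have hζ0 : ζ ≠ 0 := norm_ne_zero_iff.1 (by rw [hζ]; exact one_ne_zero)
  have hζmem : ζ ∈ closedBall (0 : ℂ) 1 := mem_closedBall_zero_iff.2 hζ.le
  have hζη : ζ ≠ -ζ := fun h => hζ0 (CharZero.eq_neg_self_iff.1 h)
  have hη1 : ‖-ζ‖ = 1 := by rw [norm_neg, hζ]
  have hη0 : -ζ ≠ 0 := neg_ne_zero.2 hζ0
  -- the rotated Cayley map `g = -ζ · cayley` (closed upper half-plane → closed disc, `g 0 = ζ`)
  -- and its inverse `G`
  obtain ⟨g, hgdef⟩ : ∃ g : ℂ → ℂ, g = fun z => -ζ * cayleyFun z := ⟨_, rfl⟩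
  obtain ⟨G, hGdef⟩ : ∃ G : ℂ → ℂ, G = fun w => cayleyInvFun ((-ζ)⁻¹ * w) := ⟨_, rfl⟩
  have hg : ∀ z, g z = -ζ * cayleyFun z := fun z => by rw [hgdef]
  have hG : ∀ w, G w = cayleyInvFun ((-ζ)⁻¹ * w) := fun w => by rw [hGdef]
  have hgc : ContinuousOn g {z : ℂ | 0 ≤ z.im} := hgdef ▸ continuousOn_mul_cayleyFun (-ζ)
  have hGc : ContinuousOn G {w : ℂ | w ≠ -ζ} := hGdef ▸ continuousOn_cayleyInvFun_inv_mul hη0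
  have hGg : ∀ z : ℂ, 0 ≤ z.im → G (g z) = z := fun z hz => by
    rw [hG, hg, cayleyInvFun_inv_mul hη0 hz]
  have hgG : ∀ w : ℂ, w ≠ -ζ → g (G w) = w := fun w hw => by
    rw [hg, hG, mul_cayleyFun_cayleyInvFun hη0 hw]
  have hgne : ∀ z : ℂ, 0 ≤ z.im → g z ≠ -ζ := fun z hz => by
    rw [hg]; exact mul_cayleyFun_ne_self hη0 hz
  have hgle : ∀ z : ℂ, 0 ≤ z.im → ‖g z‖ ≤ 1 := fun z hz => by
    rw [hg]; exact norm_mul_cayleyFun_le hη1 hz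
  have hglt : ∀ z : ℂ, 0 ≤ z.im → (‖g z‖ < 1 ↔ 0 < z.im) := fun z hz => by
    rw [hg]; exact norm_mul_cayleyFun_lt_iff hη1 hz
  have hGim : ∀ w : ℂ, ‖w‖ ≤ 1 → 0 ≤ (G w).im := fun w hw => by
    rw [hG]; exact cayleyInvFun_inv_mul_im_nonneg hη1 hw
  have hGim' : ∀ w : ℂ, ‖w‖ < 1 → 0 < (G w).im := fun w hw => by
    rw [hG]; exact cayleyInvFun_inv_mul_im_pos hη1 hw
  have hgi : InjOn g {z : ℂ | 0 ≤ z.im} := fun x hx y hy hxy =>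
    calc x = G (g x) := (hGg x hx).symm
      _ = G (g y) := by rw [hxy]
      _ = y := hGg y hy
  have hg0 : g 0 = ζ := by
    rw [hg, cayleyFun_apply, zero_sub, zero_add, neg_div, div_self I_ne_zero, neg_mul_neg, mul_one]
  have hGζ : G ζ = 0 := by
    rw [hG, inv_neg, neg_mul, inv_mul_cancel₀ hζ0, cayleyInvFun_apply]
    simp
  -- the radius `t` of the half-disc: `Ψ (g (B(0, t) ∩ {0 ≤ im})) ⊆ B(p, ρ)`
  obtain ⟨δ₁, hδ₁, hΨζ⟩ := Metric.continuousWithinAt_iff.1 (hΨc ζ hζmem) ρ hρ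
  obtain ⟨t, ht, hgt⟩ := Metric.continuousWithinAt_iff.1
    (hgc 0 (show (0 : ℂ) ∈ {z : ℂ | 0 ≤ z.im} by simp)) δ₁ hδ₁
  -- the Jordan domain `N = Ψ (g (half-disc of radius t))`
  have hHcl : closure (halfDisc t ht).carrier = closedBall (0 : ℂ) t ∩ {z : ℂ | 0 ≤ z.im} := by
    rw [carrier_halfDisc, closure_ball_inter_upperHalfPlaneSet ht]
  have hsubH : closure (halfDisc t ht).carrier ⊆ {z : ℂ | 0 ≤ z.im} :=
    hHcl ▸ inter_subset_right
  have hmaps : MapsTo g (closure (halfDisc t ht).carrier) (closedBall 0 1) := fun z hz =>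
    mem_closedBall_zero_iff.2 (hgle z (hsubH hz))
  have hhc : ContinuousOn (Ψ ∘ g) (closure (halfDisc t ht).carrier) :=
    hΨc.comp (hgc.mono hsubH) hmaps
  have hhi : InjOn (Ψ ∘ g) (closure (halfDisc t ht).carrier) :=
    hΨi.comp (hgi.mono hsubH) hmaps
  have hNcl : closure ((halfDisc t ht).image (Ψ ∘ g) hhc hhi).carrier =
      (Ψ ∘ g) '' (closedBall (0 : ℂ) t ∩ {z : ℂ | 0 ≤ z.im}) := by
    rw [JordanDomain.closure_carrier_image, hHcl]
  -- the radius `r`: points of `D ∩ B(p, r)` are `Ψ (g u)` with `‖u‖ < t / 4`, `0 < im u`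
  have hGat : ContinuousAt G ζ := hGc.continuousAt (isOpen_ne.mem_nhds hζη)
  obtain ⟨ε₁, hε₁, hGε⟩ := Metric.continuousAt_iff.1 hGat (t / 4) (by positivity)
  obtain ⟨r, hr, hrU⟩ := hU ε₁ hε₁
  have hcap : ∀ z ∈ D.carrier, dist z p < r →
      ∃ u : ℂ, ‖u‖ < t / 4 ∧ 0 < u.im ∧ Ψ (g u) = z := by
    intro z hz hzp
    rw [← hΨball] at hz
    obtain ⟨x, hx, rfl⟩ := hz
    have hx1 : ‖x‖ < 1 := mem_ball_zero_iff.1 hx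
    have hxη : x ≠ -ζ := fun h => by
      rw [h, hη1] at hx1
      exact lt_irrefl _ hx1
    have hxζ : dist x ζ < ε₁ := hrU x (ball_subset_closedBall hx) ζ hζmem (by rwa [hζp])
    refine ⟨G x, ?_, hGim' x hx1, by rw [hgG x hxη]⟩
    have := hGε hxζ
    rwa [hGζ, dist_zero_right] at this
  -- the compact sets `Q s = g (closed half-disc of radius s)` and
  -- `K s = 𝔻̄ ∖ g (half-disc of radius s with its diameter)` and their positive distances
  have hHc : IsClosed {z : ℂ | 0 ≤ z.im} := isClosed_le continuous_const continuous_im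
  have hQc : ∀ s : ℝ, IsCompact (g '' (closedBall (0 : ℂ) s ∩ {z : ℂ | 0 ≤ z.im})) := fun s =>
    ((isCompact_closedBall 0 s).inter_right hHc).image_of_continuousOn
      (hgc.mono inter_subset_right)
  have hKc : ∀ s : ℝ,
      IsCompact (closedBall (0 : ℂ) 1 ∩ ({w : ℂ | w ≠ -ζ} ∩ G ⁻¹' ball 0 s)ᶜ) := fun s =>
    (isCompact_closedBall 0 1).inter_right
      (hGc.isOpen_inter_preimage isOpen_ne isOpen_ball).isClosed_compl
  have hQK : ∀ s₁ s₂ : ℝ, s₁ < s₂ → ∀ x ∈ g '' (closedBall (0 : ℂ) s₁ ∩ {z : ℂ | 0 ≤ z.im}),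
      ∀ y ∈ closedBall (0 : ℂ) 1 ∩ ({w : ℂ | w ≠ -ζ} ∩ G ⁻¹' ball 0 s₂)ᶜ, x ≠ y := by
    rintro s₁ s₂ hs _ ⟨z, ⟨hzs, hzim⟩, rfl⟩ y ⟨-, hy⟩ heq
    have hzim : 0 ≤ z.im := hzim
    apply hy
    rw [← heq]
    refine ⟨hgne z hzim, ?_⟩
    show G (g z) ∈ ball (0 : ℂ) s₂
    rw [hGg z hzim, mem_ball_zero_iff]
    exact (mem_closedBall_zero_iff.1 hzs).trans_lt hs
  obtain ⟨d₂, hd₂, hd₂le⟩ :=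
    exists_pos_forall_le_dist (hQc (t / 2)) (hKc (3 * t / 4)) (hQK (t / 2) (3 * t / 4) (by linarith))
  obtain ⟨d₃, hd₃, hd₃le⟩ :=
    exists_pos_forall_le_dist (hQc (t / 4)) (hKc (t / 2)) (hQK (t / 4) (t / 2) (by linarith))
  obtain ⟨m, hm, hmU⟩ := hU d₂ hd₂
  obtain ⟨L, hL, hLU⟩ := hU d₃ hd₃
  refine ⟨(halfDisc t ht).image (Ψ ∘ g) hhc hhi, r, m, L, hr, hm, hL, ?_, ?_, ?_, ?_⟩
  · -- `N ⊆ D`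
    rintro _ ⟨v, ⟨-, hvim⟩, rfl⟩
    have hvim : 0 < v.im := hvim
    rw [← hΨball]
    exact ⟨g v, mem_ball_zero_iff.2 ((hglt v hvim.le).2 hvim), rfl⟩
  · -- `N ⊆ B(p, ρ)`
    rintro _ ⟨v, ⟨hvt, hvim⟩, rfl⟩
    have hvim : 0 < v.im := hvim
    have h1 : dist (g v) ζ < δ₁ := by
      have := hgt (show v ∈ {z : ℂ | 0 ≤ z.im} from hvim.le) (mem_ball.1 hvt)
      rwa [hg0] at this
    have h2 := hΨζ (mem_closedBall_zero_iff.2 (hgle v hvim.le)) h1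
    rw [hζp] at h2
    exact h2
  · -- `D ∩ B(p, r) ⊆ N`
    intro z hz hzp
    obtain ⟨u, hut, huim, rfl⟩ := hcap z hz hzp
    exact ⟨u, ⟨mem_ball_zero_iff.2 (by linarith), huim⟩, rfl⟩
  · -- separation
    rintro _ ⟨v, ⟨hvt, hvim⟩, rfl⟩ c hc hcase hac z hz hzp
    have hvim : 0 < v.im := hvim
    obtain ⟨γ, hγ, rfl⟩ := hbij.surjOn hc
    have hγ1 : ‖γ‖ ≤ 1 := mem_closedBall_zero_iff.1 hγ
    -- the preimage `γ` of `c` lies in `K (3t/4)`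
    have hγK : γ ∈ closedBall (0 : ℂ) 1 ∩ ({w : ℂ | w ≠ -ζ} ∩ G ⁻¹' ball 0 (3 * t / 4))ᶜ := by
      refine ⟨hγ, fun hmem => ?_⟩
      obtain ⟨hγη, hγG⟩ := hmem
      have hγη : γ ≠ -ζ := hγη
      have hγG : ‖G γ‖ < 3 * t / 4 := mem_ball_zero_iff.1 hγG
      have hγim : 0 ≤ (G γ).im := hGim γ hγ1
      have hγeq : g (G γ) = γ := hgG γ hγη
      rcases hcase with ⟨hcD, hcN⟩ | hccl
      · rw [← hΨball] at hcD
        obtain ⟨x, hx, hxeq⟩ := hcD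
        have hxγ : x = γ := hΨi (ball_subset_closedBall hx) hγ hxeq
        subst hxγ
        have hγlt : ‖g (G x)‖ < 1 := by rw [hγeq]; exact mem_ball_zero_iff.1 hx
        have hGim'' : 0 < (G x).im := (hglt _ hγim).1 hγlt
        exact hcN ⟨G x, ⟨mem_ball_zero_iff.2 (by linarith), hGim''⟩,
          show Ψ (g (G x)) = Ψ x by rw [hγeq]⟩
      · apply hccl
        rw [hNcl]
        exact ⟨G γ, ⟨mem_closedBall_zero_iff.2 (by linarith), hγim⟩,
          show Ψ (g (G γ)) = Ψ γ by rw [hγeq]⟩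
    -- `α = g v` is `d₂`-close to `γ`, hence outside `Q (t/2)`, hence in `K (t/2)`
    have hα1 : ‖g v‖ < 1 := (hglt v hvim.le).2 hvim
    have hαγ : dist (g v) γ < d₂ := hmU (g v) (mem_closedBall_zero_iff.2 hα1.le) γ hγ hac
    have hαQ : g v ∉ g '' (closedBall (0 : ℂ) (t / 2) ∩ {z : ℂ | 0 ≤ z.im}) := fun h =>
      (not_lt.2 (hd₂le _ h γ hγK)) hαγ
    have hαK : g v ∈ closedBall (0 : ℂ) 1 ∩ ({w : ℂ | w ≠ -ζ} ∩ G ⁻¹' ball 0 (t / 2))ᶜ := by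
      refine ⟨mem_closedBall_zero_iff.2 hα1.le, fun hmem => ?_⟩
      obtain ⟨-, hGv⟩ := hmem
      have hGv : ‖G (g v)‖ < t / 2 := mem_ball_zero_iff.1 hGv
      rw [hGg v hvim.le] at hGv
      exact hαQ ⟨v, ⟨mem_closedBall_zero_iff.2 hGv.le, hvim.le⟩, rfl⟩
    -- the point `z = Ψ (g u)` has `g u ∈ Q (t/4)`, at distance `≥ d₃` from `g v`
    obtain ⟨u, hut, huim, rfl⟩ := hcap z hz hzp
    have huQ : g u ∈ g '' (closedBall (0 : ℂ) (t / 4) ∩ {z : ℂ | 0 ≤ z.im}) :=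
      ⟨u, ⟨mem_closedBall_zero_iff.2 hut.le, huim.le⟩, rfl⟩
    have hd : d₃ ≤ dist (g u) (g v) := hd₃le _ huQ _ hαK
    by_contra hlt
    exact (not_lt.2 hd) (hLU (g u) (mem_closedBall_zero_iff.2 (hgle u huim.le)) (g v)
      (mem_closedBall_zero_iff.2 hα1.le) (not_le.1 hlt))

end Summit.CriticalPhenomena.SAWScalingLimit.Theorems.AvoidanceLimit.Anchor

end
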